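import Mathlib
import HarnessLib

/-!
# `stub_mbb_of_boxInputs` (line `Sketch`, crux `SplitBlockJacobiCorner`, stmt-Parity-15002):
# size bookkeeping, part A — elementary real-power facts of the corner box

Pure real analysis (no kernel).  Throughout `0 < η < 2`, `δ₀ = η/50`, `p = P₁ ≥ 3`,
`P₁ ≤ P₂ ≤ 8 P₁^{1+δ₀}`, `X = P₁P₂`, `U = ⌊P₁^{η/10}⌋`.  Each fact of `…MbbParams.params` is
proved here from an explicit LARGENESS hypothesis of the single shape `κ ≤ P₁^{a}` (`a > 0`), so
that part C only has to choose `P₀` with finitely many such conditions.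
-/

noncomputable section

open Real

namespace Summit.Parity.BatemanHorn.Cruxes.SplitBlockJacobiCorner.Sketch.MbbOfBoxInputs

/-! ### Tools -/

/-- Monomial comparison: `κ p^e ≤ θ p^f` as soon as `κ ≤ θ p^{f−e}` (`p > 0`). [folklore] -/
theorem monomial_le {p κ θ e f : ℝ} (hp : 0 < p) (h : κ ≤ θ * p ^ (f - e)) :
    κ * p ^ e ≤ θ * p ^ f := by
  have he : 0 < p ^ e := rpow_pos_of_pos hp e
  calc κ * p ^ e ≤ θ * p ^ (f - e) * p ^ e := mul_le_mul_of_nonneg_right h he.le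
    _ = θ * p ^ f := by rw [mul_assoc, ← rpow_add hp]; ring_nf

/-- `X = P₁P₂ ≤ 8 P₁^{2+δ₀}` from the aspect bound. [folklore] -/
theorem X_le {p q δ₀ : ℝ} (hp : 0 < p) (hasp : q ≤ 8 * p ^ (1 + δ₀)) :
    p * q ≤ 8 * p ^ (2 + δ₀) := by
  calc p * q ≤ p * (8 * p ^ (1 + δ₀)) := mul_le_mul_of_nonneg_left hasp hp.le
    _ = 8 * (p ^ (1 : ℝ) * p ^ (1 + δ₀)) := by rw [rpow_one]; ring
    _ = 8 * p ^ (2 + δ₀) := by rw [← rpow_add hp]; ring_nf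

/-- `(U : ℝ) ≤ p^{η/10}` and `p^{η/10} − 1 < U` for `U = ⌊p^{η/10}⌋`. [folklore] -/
theorem U_bounds {p η : ℝ} (hp : 0 ≤ p) :
    ((⌊p ^ (η / 10)⌋₊ : ℕ) : ℝ) ≤ p ^ (η / 10) ∧ p ^ (η / 10) - 1 < ((⌊p ^ (η / 10)⌋₊ : ℕ) : ℝ) :=
  ⟨Nat.floor_le (rpow_nonneg hp _), Nat.sub_one_lt_floor _⟩

/-- `(U·U : ℝ) ≤ p^{η/5}`. [folklore] -/
theorem UU_le {p η : ℝ} (hp : 0 < p) :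
    ((⌊p ^ (η / 10)⌋₊ * ⌊p ^ (η / 10)⌋₊ : ℕ) : ℝ) ≤ p ^ (η / 5) := by
  have hU := (U_bounds (η := η) hp.le).1
  have hU0 : (0 : ℝ) ≤ ((⌊p ^ (η / 10)⌋₊ : ℕ) : ℝ) := Nat.cast_nonneg _
  push_cast
  calc _ ≤ p ^ (η / 10) * p ^ (η / 10) := mul_le_mul hU hU hU0 (rpow_nonneg hp.le _)
    _ = p ^ (η / 5) := by rw [← rpow_add hp]; ring_nf

/-! ### The facts, one by one (`p = P₁`) -/

/-- F2–F3: `1 ≤ U ≤ P₁` (`η ≤ 10`, `P₁ ≥ 1`). [folklore] -/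
theorem fact_U_basic {P₁ : ℕ} {η : ℝ} (hη : 0 < η) (hη10 : η ≤ 10) (hP₁ : 1 ≤ P₁) :
    1 ≤ ⌊(P₁ : ℝ) ^ (η / 10)⌋₊ ∧ ⌊(P₁ : ℝ) ^ (η / 10)⌋₊ ≤ P₁ := by
  have hp : (1 : ℝ) ≤ P₁ := by exact_mod_cast hP₁
  constructor
  · rw [Nat.one_le_floor_iff]
    exact one_le_rpow hp (by positivity)
  · have h1 : (P₁ : ℝ) ^ (η / 10) ≤ (P₁ : ℝ) ^ (1 : ℝ) :=
      rpow_le_rpow_of_exponent_le hp (by linarith)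
    rw [rpow_one] at h1
    have := Nat.floor_le_floor h1
    rwa [Nat.floor_natCast] at this

/-- F4: `2U² ≤ P₁` from `2 ≤ P₁^{1−η/5}`. [folklore] -/
theorem fact_UU {P₁ : ℕ} {η : ℝ} (hP₁ : 1 ≤ P₁) (hlarge : 2 ≤ (P₁ : ℝ) ^ (1 - η / 5)) :
    2 * (⌊(P₁ : ℝ) ^ (η / 10)⌋₊ * ⌊(P₁ : ℝ) ^ (η / 10)⌋₊) ≤ P₁ := by
  have hp : (0 : ℝ) < P₁ := by exact_mod_cast (by omega : 0 < P₁)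
  have h1 := UU_le (η := η) hp
  have h2 : 2 * (P₁ : ℝ) ^ (η / 5) ≤ (P₁ : ℝ) := by
    have := monomial_le (κ := 2) (θ := 1) (e := η / 5) (f := 1) hp (by rw [one_mul]; convert hlarge using 2)
    rwa [one_mul, rpow_one] at this
  have : ((2 * (⌊(P₁ : ℝ) ^ (η / 10)⌋₊ * ⌊(P₁ : ℝ) ^ (η / 10)⌋₊) : ℕ) : ℝ) ≤ (P₁ : ℝ) := by
    push_cast at h1 ⊢
    linarith
  exact_mod_cast this

/-- F6: `1 ≤ L = log(4X)` (`X ≥ 1`). [folklore] -/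
theorem fact_L {X : ℝ} (hX : 1 ≤ X) : 1 ≤ Real.log (4 * X) := by
  rw [Real.le_log_iff_exp_le (by positivity)]
  have := Real.exp_one_lt_d9
  linarith

/-- F7: `1 ≤ D = C (4X)^ε` (`C ≥ 1`, `X ≥ 1`, `ε ≥ 0`). [folklore] -/
theorem fact_D {X C ε : ℝ} (hX : 1 ≤ X) (hC : 1 ≤ C) (hε : 0 ≤ ε) : 1 ≤ C * (4 * X) ^ ε := by
  have : (1 : ℝ) ≤ (4 * X) ^ ε := one_le_rpow (by linarith) hε
  nlinarith

/-- F8: `log n ≤ log(4X)` for `n ≤ 4P₁P₂`. [folklore] -/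
theorem fact_Ln {P₁ P₂ : ℕ} (hP₁ : 1 ≤ P₁) (hP₂ : 1 ≤ P₂) :
    ∀ n : ℕ, n ≤ 4 * (P₁ * P₂) → Real.log n ≤ Real.log (4 * ((P₁ : ℝ) * P₂)) := by
  intro n hn
  rcases Nat.eq_zero_or_pos n with rfl | hn0
  · simp only [Nat.cast_zero, Real.log_zero]
    exact Real.log_nonneg (by
      have : (1 : ℝ) ≤ P₁ := by exact_mod_cast hP₁
      have : (1 : ℝ) ≤ P₂ := by exact_mod_cast hP₂
      nlinarith)
  · apply Real.log_le_log (by exact_mod_cast hn0)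
    exact_mod_cast hn

/-- F9: `τ(n) ≤ C (4X)^ε` for `n ≤ 4P₁P₂` from the divisor bound. [folklore] -/
theorem fact_Dn {P₁ P₂ : ℕ} {C ε : ℝ} (hC : 0 ≤ C) (hε : 0 ≤ ε)
    (hτ : ∀ n : ℕ, (n.divisors.card : ℝ) ≤ C * (n : ℝ) ^ ε) :
    ∀ n : ℕ, n ≤ 4 * (P₁ * P₂) → (n.divisors.card : ℝ) ≤ C * (4 * ((P₁ : ℝ) * P₂)) ^ ε := by
  intro n hn
  refine (hτ n).trans (mul_le_mul_of_nonneg_left (rpow_le_rpow (Nat.cast_nonneg _) ?_ hε) hC)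
  exact_mod_cast hn

/-- `Nat.log 2 m ≤ 2 log(4X)` for `m ≤ 4X`, `m ≥ 1` (`log 2 > 1/2`). [folklore] -/
theorem natlog_le {m : ℕ} {X : ℝ} (hm : 1 ≤ m) (hmX : (m : ℝ) ≤ 4 * X) :
    (Nat.log 2 m : ℝ) ≤ 2 * Real.log (4 * X) := by
  have h1 : 2 ^ Nat.log 2 m ≤ m := Nat.pow_log_le_self 2 (by omega)
  have h2 : ((2 ^ Nat.log 2 m : ℕ) : ℝ) ≤ m := by exact_mod_cast h1
  have h3 : Real.log ((2 ^ Nat.log 2 m : ℕ) : ℝ) ≤ Real.log (4 * X) :=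
    Real.log_le_log (by positivity) (h2.trans hmX)
  push_cast at h3
  rw [Real.log_pow] at h3
  have h4 := Real.log_two_gt_d9
  have h5 : 0 ≤ (Nat.log 2 m : ℝ) := Nat.cast_nonneg _
  nlinarith

/-- F10: `Nat.log 2 (2P₂) + 1 ≤ 3L`. [folklore] -/
theorem fact_I {P₁ P₂ : ℕ} (hP₁ : 1 ≤ P₁) (hP₂ : 1 ≤ P₂) (hL : 1 ≤ Real.log (4 * ((P₁ : ℝ) * P₂))) :
    ((Nat.log 2 (2 * P₂) + 1 : ℕ) : ℝ) ≤ 3 * Real.log (4 * ((P₁ : ℝ) * P₂)) := by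
  have h := natlog_le (m := 2 * P₂) (X := (P₁ : ℝ) * P₂) (by omega) (by
    push_cast
    have : (1 : ℝ) ≤ P₁ := by exact_mod_cast hP₁
    have : (0 : ℝ) ≤ P₂ := Nat.cast_nonneg _
    nlinarith)
  push_cast
  linarith

/-- F11/F14/F20: from `κ ≤ P₁^{η−δ₀}`: `κ' P₁^{1+δ₀} ≤ θ P₁^{1+η}`-type consequences. Concretely:
`P₂ ≤ (P₁/4)^{1+η}`, `2P₂ ≤ P₁^{1+η}`, `2P₂ ≤ (P₁/2)^{1+η}` given the aspect bound and
`16·4^{1+η} ≤ P₁^{η−δ₀}`. [folklore] -/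
theorem fact_aspect {P₁ : ℕ} {q η δ₀ : ℝ} (hη : 0 < η) (hP₁ : 1 ≤ P₁)
    (hasp : q ≤ 8 * (P₁ : ℝ) ^ (1 + δ₀)) (hlarge : 16 * 4 ^ (1 + η) ≤ (P₁ : ℝ) ^ (η - δ₀)) :
    q ≤ ((P₁ : ℝ) / 4) ^ (1 + η) ∧ 2 * q ≤ (P₁ : ℝ) ^ (1 + η) ∧ 2 * q ≤ ((P₁ : ℝ) / 2) ^ (1 + η) := by
  have hp : (0 : ℝ) < P₁ := by exact_mod_cast (by omega : 0 < P₁)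
  have h4 : (0 : ℝ) < 4 ^ (1 + η) := by positivity
  have h2 : (0 : ℝ) < 2 ^ (1 + η) := by positivity
  have h24 : (2 : ℝ) ^ (1 + η) ≤ 4 ^ (1 + η) := rpow_le_rpow (by norm_num) (by norm_num) (by linarith)
  -- `16 · 4^{1+η} · P₁^{1+δ₀} ≤ P₁^{1+η}`
  have key : 16 * 4 ^ (1 + η) * (P₁ : ℝ) ^ (1 + δ₀) ≤ 1 * (P₁ : ℝ) ^ (1 + η) :=
    monomial_le hp (by rw [one_mul]; convert hlarge using 2; ring)
  rw [one_mul] at key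
  have hP0 : (0 : ℝ) ≤ (P₁ : ℝ) ^ (1 + δ₀) := rpow_nonneg hp.le _
  have hone : (1 : ℝ) ≤ 4 ^ (1 + η) := one_le_rpow (by norm_num) (by linarith)
  have hq16 : 2 * q ≤ 16 * (P₁ : ℝ) ^ (1 + δ₀) := by linarith
  refine ⟨?_, ?_, ?_⟩
  · rw [div_rpow hp.le (by norm_num), le_div_iff₀ h4]
    calc q * 4 ^ (1 + η) ≤ (8 * (P₁ : ℝ) ^ (1 + δ₀)) * 4 ^ (1 + η) :=
          mul_le_mul_of_nonneg_right hasp h4.le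
      _ ≤ 16 * 4 ^ (1 + η) * (P₁ : ℝ) ^ (1 + δ₀) := by nlinarith
      _ ≤ _ := key
  · calc 2 * q ≤ 16 * (P₁ : ℝ) ^ (1 + δ₀) := hq16
      _ ≤ 16 * 4 ^ (1 + η) * (P₁ : ℝ) ^ (1 + δ₀) := by nlinarith
      _ ≤ _ := key
  · rw [div_rpow hp.le (by norm_num), le_div_iff₀ h2]
    calc 2 * q * 2 ^ (1 + η) ≤ (16 * (P₁ : ℝ) ^ (1 + δ₀)) * 4 ^ (1 + η) :=
          mul_le_mul hq16 h24 h2.le (by positivity)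
      _ = 16 * 4 ^ (1 + η) * (P₁ : ℝ) ^ (1 + δ₀) := by ring
      _ ≤ _ := key

/-- F12: `2P₁ ≤ P₂^{1+η}` from `2 ≤ P₁^η`, `P₁ ≤ P₂`. [folklore] -/
theorem fact_A2 {P₁ P₂ : ℕ} {η : ℝ} (hη : 0 < η) (hP₁ : 1 ≤ P₁) (hP₁P₂ : P₁ ≤ P₂)
    (hlarge : 2 ≤ (P₁ : ℝ) ^ η) : (2 * P₁ : ℝ) ≤ (P₂ : ℝ) ^ (1 + η) := by
  have hp : (0 : ℝ) < P₁ := by exact_mod_cast (by omega : 0 < P₁)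
  have hq : (P₁ : ℝ) ≤ P₂ := by exact_mod_cast hP₁P₂
  calc (2 * P₁ : ℝ) ≤ (P₁ : ℝ) ^ η * P₁ := by nlinarith
    _ = (P₁ : ℝ) ^ (1 + η) := by rw [rpow_add hp, rpow_one]; ring
    _ ≤ (P₂ : ℝ) ^ (1 + η) := rpow_le_rpow hp.le hq (by linarith)

/-- F13/F21: `P₁ ≤ (P₁/4)^{1+η}` and `2P₁ ≤ (P₁/2)^{1+η}` from `4^{1+η} ≤ P₁^η`. [folklore] -/
theorem fact_B1 {P₁ : ℕ} {η : ℝ} (hη : 0 < η) (hP₁ : 1 ≤ P₁) (hlarge : 4 ^ (1 + η) ≤ (P₁ : ℝ) ^ η) :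
    (P₁ : ℝ) ≤ ((P₁ : ℝ) / 4) ^ (1 + η) ∧ (2 * P₁ : ℝ) ≤ ((P₁ : ℝ) / 2) ^ (1 + η) := by
  have hp : (0 : ℝ) < P₁ := by exact_mod_cast (by omega : 0 < P₁)
  have e : (P₁ : ℝ) ^ (1 + η) = P₁ * (P₁ : ℝ) ^ η := by rw [rpow_add hp, rpow_one]
  have h24 : 2 * (2 : ℝ) ^ (1 + η) ≤ 4 ^ (1 + η) := by
    rw [show (4 : ℝ) = 2 * 2 by norm_num, mul_rpow (by norm_num) (by norm_num)]
    apply mul_le_mul_of_nonneg_right _ (by positivity)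
    have := rpow_le_rpow_of_exponent_le (show (1 : ℝ) ≤ 2 by norm_num) (show (1 : ℝ) ≤ 1 + η by linarith)
    rwa [rpow_one] at this
  constructor
  · rw [div_rpow hp.le (by norm_num), le_div_iff₀ (by positivity), e]
    nlinarith
  · rw [div_rpow hp.le (by norm_num), le_div_iff₀ (by positivity), e]
    nlinarith [rpow_nonneg hp.le η]

/-- F15: `(2X)^{η/25} ≤ U` from `16^{η/25} + 1 ≤ P₁^{η/10 − (2+δ₀)η/25}`. [folklore] -/
theorem fact_S1 {P₁ : ℕ} {q η δ₀ : ℝ} (hη : 0 < η) (hδ : 0 ≤ δ₀) (hP₁ : 1 ≤ P₁) (hq : 0 ≤ q)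
    (hasp : q ≤ 8 * (P₁ : ℝ) ^ (1 + δ₀))
    (hlarge : 16 ^ (η / 25) + 1 ≤ (P₁ : ℝ) ^ (η / 10 - (2 + δ₀) * (η / 25))) :
    (2 * ((P₁ : ℝ) * q)) ^ (η / 25) ≤ ((⌊(P₁ : ℝ) ^ (η / 10)⌋₊ : ℕ) : ℝ) := by
  have hp : (0 : ℝ) < P₁ := by exact_mod_cast (by omega : 0 < P₁)
  have hX := X_le hp hasp
  have h1 : (2 * ((P₁ : ℝ) * q)) ^ (η / 25) ≤ (16 * (P₁ : ℝ) ^ (2 + δ₀)) ^ (η / 25) :=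
    rpow_le_rpow (by positivity) (by linarith) (by positivity)
  rw [mul_rpow (by norm_num) (rpow_nonneg hp.le _), ← rpow_mul hp.le] at h1
  have hU := (U_bounds (η := η) hp.le).2
  -- `16^{η/25} P₁^{a} + 1 ≤ P₁^{η/10}` with `a = (2+δ₀)η/25`
  have ha1 : (1 : ℝ) ≤ (P₁ : ℝ) ^ ((2 + δ₀) * (η / 25)) := one_le_rpow (by exact_mod_cast hP₁) (by positivity)
  have key : (16 ^ (η / 25) + 1) * (P₁ : ℝ) ^ ((2 + δ₀) * (η / 25)) ≤ 1 * (P₁ : ℝ) ^ (η / 10) :=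
    monomial_le hp (by rw [one_mul]; exact hlarge)
  have h16 : (0 : ℝ) ≤ 16 ^ (η / 25) := by positivity
  nlinarith

/-- F16: `√(2P₁) ≤ (X/4)^{1/4+η/100}` from `2·4^{1/2+η/50} ≤ P₁^{η/25}` (`X ≥ P₁²`). [folklore] -/
theorem fact_S2 {P₁ : ℕ} {q η : ℝ} (hη : 0 < η) (hP₁ : 1 ≤ P₁) (hq : (P₁ : ℝ) ≤ q)
    (hlarge : 2 * 4 ^ (1 / 2 + η / 50) ≤ (P₁ : ℝ) ^ (η / 25)) :
    Real.sqrt (2 * P₁) ≤ (((P₁ : ℝ) * q) / 4) ^ (1 / 4 + η / 100) := by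
  have hp : (0 : ℝ) < P₁ := by exact_mod_cast (by omega : 0 < P₁)
  have hq0 : 0 < q := lt_of_lt_of_le hp hq
  have hX4 : (P₁ : ℝ) ^ (2 : ℝ) / 4 ≤ ((P₁ : ℝ) * q) / 4 := by
    rw [rpow_two]; apply div_le_div_of_nonneg_right _ (by norm_num); nlinarith
  have hXq0 : (0 : ℝ) ≤ ((P₁ : ℝ) * q) / 4 := by positivity
  -- square both sides
  rw [show (1 / 4 + η / 100 : ℝ) = (1 / 2 + η / 50) * (1 / 2) by ring, rpow_mul hXq0,
    ← Real.sqrt_eq_rpow]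
  apply Real.sqrt_le_sqrt
  refine le_trans ?_ (rpow_le_rpow (by positivity) hX4 (by positivity))
  rw [div_rpow (by positivity) (by norm_num), ← rpow_mul hp.le, le_div_iff₀ (by positivity)]
  have e : (2 : ℝ) * ((1 / 2 + η / 50)) = 1 + η / 25 := by ring
  rw [e, rpow_add hp, rpow_one]
  nlinarith [rpow_nonneg hp.le (η / 25), hlarge]

/-- F17: `√(2P₂) ≤ (X/4)^{1/4+η/100}` from `32·4^{1+η/25} ≤ P₁^{η/25 − δ₀}` (aspect bound,
`X ≥ P₁`). [folklore] -/
theorem fact_S3 {P₁ : ℕ} {q η δ₀ : ℝ} (hδ : 0 < δ₀) (hδη : δ₀ < η / 25) (hP₁ : 1 ≤ P₁)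
    (hq : (P₁ : ℝ) ≤ q) (hasp : q ≤ 8 * (P₁ : ℝ) ^ (1 + δ₀))
    (hlarge : 32 * 4 ^ (1 + η / 25) ≤ (P₁ : ℝ) ^ (η / 25 - δ₀)) :
    Real.sqrt (2 * q) ≤ (((P₁ : ℝ) * q) / 4) ^ (1 / 4 + η / 100) := by
  have hp : (0 : ℝ) < P₁ := by exact_mod_cast (by omega : 0 < P₁)
  have hp1 : (1 : ℝ) ≤ P₁ := by exact_mod_cast hP₁
  have hq0 : 0 < q := lt_of_lt_of_le hp hq
  set X : ℝ := (P₁ : ℝ) * q with hXdef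
  have hX0 : 0 < X := by positivity
  have hXP : (P₁ : ℝ) ≤ X := by rw [hXdef]; nlinarith
  have hX1 : 1 ≤ X := hp1.trans hXP
  -- `(2q)^2 ≤ 32 X^{1+δ₀}`
  have hsq : (2 * q) ^ 2 ≤ 32 * X ^ (1 + δ₀) := by
    have e1 : q * q ≤ 8 * (P₁ : ℝ) ^ (1 + δ₀) * q := by nlinarith
    have e2 : (P₁ : ℝ) ^ (1 + δ₀) * q = (P₁ : ℝ) ^ δ₀ * X := by
      rw [hXdef, rpow_add hp, rpow_one]; ring
    have e3 : (P₁ : ℝ) ^ δ₀ ≤ X ^ δ₀ := rpow_le_rpow hp.le hXP hδ.le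
    have e4 : X ^ δ₀ * X = X ^ (1 + δ₀) := by rw [rpow_add hX0, rpow_one]; ring
    nlinarith [rpow_nonneg hp.le δ₀]
  -- `32 X^{1+δ₀} ≤ (X/4)^{1+η/25}` from the largeness (via `X ≥ P₁`)
  have hlargeX : 32 * 4 ^ (1 + η / 25) ≤ X ^ (η / 25 - δ₀) :=
    hlarge.trans (rpow_le_rpow hp.le hXP (by linarith))
  have hmain : 32 * X ^ (1 + δ₀) ≤ (X / 4) ^ (1 + η / 25) := by
    rw [div_rpow hX0.le (by norm_num), le_div_iff₀ (by positivity)]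
    have := monomial_le (κ := 32 * 4 ^ (1 + η / 25)) (θ := 1) (e := 1 + δ₀) (f := 1 + η / 25) hX0
      (by rw [one_mul]; convert hlargeX using 2; ring)
    linarith
  -- take square roots twice
  have h2q : 2 * q ≤ (X / 4) ^ ((1 + η / 25) / 2) := by
    have : (2 * q) ^ 2 ≤ ((X / 4) ^ ((1 + η / 25) / 2)) ^ 2 := by
      rw [← rpow_natCast ((X / 4) ^ ((1 + η / 25) / 2)) 2, ← rpow_mul (by positivity)]
      push_cast
      rw [show (1 + η / 25) / 2 * 2 = 1 + η / 25 by ring]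
      linarith
    exact (pow_le_pow_iff_left₀ (by positivity) (by positivity) (by norm_num)).mp this
  rw [show (1 / 4 + η / 100 : ℝ) = ((1 + η / 25) / 2) * (1 / 2) by ring, rpow_mul (by positivity),
    ← Real.sqrt_eq_rpow]
  exact Real.sqrt_le_sqrt h2q

/-- F18: `|h| ≤ (X/4)^{η/25}` from `|h| ≤ X^{η/50}` and `4^{η/25} ≤ P₁^{η/50}`. [folklore] -/
theorem fact_freq {P₁ : ℕ} {q η A : ℝ} (hη : 0 < η) (hP₁ : 1 ≤ P₁) (hq : (P₁ : ℝ) ≤ q)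
    (hA : A ≤ ((P₁ : ℝ) * q) ^ (η / 50)) (hlarge : 4 ^ (η / 25) ≤ (P₁ : ℝ) ^ (η / 50)) :
    A ≤ (((P₁ : ℝ) * q) / 4) ^ (η / 25) := by
  have hp : (0 : ℝ) < P₁ := by exact_mod_cast (by omega : 0 < P₁)
  have hp1 : (1 : ℝ) ≤ P₁ := by exact_mod_cast hP₁
  have hq1 : 1 ≤ q := hp1.trans hq
  set X : ℝ := (P₁ : ℝ) * q with hXdef
  have hX0 : 0 < X := by rw [hXdef]; nlinarith
  have hXP : (P₁ : ℝ) ≤ X := by rw [hXdef]; nlinarith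
  have hlargeX : 4 ^ (η / 25) ≤ X ^ (η / 50) := hlarge.trans (rpow_le_rpow hp.le hXP (by positivity))
  refine hA.trans ?_
  rw [div_rpow hX0.le (by norm_num), le_div_iff₀ (by positivity)]
  have := monomial_le (κ := 4 ^ (η / 25)) (θ := 1) (e := η / 50) (f := η / 25) hX0
    (by rw [one_mul]; convert hlargeX using 2; ring)
  linarith

/-- F19: `|h| ≤ (P₁/2)^η` from `|h| ≤ X^{δ₀}` and `8^{δ₀} 2^η ≤ P₁^{η − (2+δ₀)δ₀}`. [folklore] -/
theorem fact_C4 {P₁ : ℕ} {q η δ₀ A : ℝ} (hδ : 0 < δ₀) (hP₁ : 1 ≤ P₁) (hq0 : 0 ≤ q)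
    (hasp : q ≤ 8 * (P₁ : ℝ) ^ (1 + δ₀)) (hA : A ≤ ((P₁ : ℝ) * q) ^ δ₀)
    (hlarge : 8 ^ δ₀ * 2 ^ η ≤ (P₁ : ℝ) ^ (η - (2 + δ₀) * δ₀)) :
    A ≤ ((P₁ : ℝ) / 2) ^ η := by
  have hp : (0 : ℝ) < P₁ := by exact_mod_cast (by omega : 0 < P₁)
  have hX := X_le hp hasp
  have h1 : ((P₁ : ℝ) * q) ^ δ₀ ≤ (8 * (P₁ : ℝ) ^ (2 + δ₀)) ^ δ₀ :=
    rpow_le_rpow (by positivity) hX hδ.le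
  rw [mul_rpow (by norm_num) (rpow_nonneg hp.le _), ← rpow_mul hp.le] at h1
  refine hA.trans (h1.trans ?_)
  rw [div_rpow hp.le (by norm_num), le_div_iff₀ (by positivity)]
  have := monomial_le (κ := 8 ^ δ₀ * 2 ^ η) (θ := 1) (e := (2 + δ₀) * δ₀) (f := η) hp
    (by rw [one_mul]; exact hlarge)
  nlinarith [rpow_nonneg hp.le ((2 + δ₀) * δ₀), this]

/-- F22: `U·U ≤ (P₁/2)^{η/4}` from `2^{η/4} ≤ P₁^{η/20}`. [folklore] -/
theorem fact_C3 {P₁ : ℕ} {η : ℝ} (hP₁ : 1 ≤ P₁) (hlarge : 2 ^ (η / 4) ≤ (P₁ : ℝ) ^ (η / 20)) :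
    ((⌊(P₁ : ℝ) ^ (η / 10)⌋₊ * ⌊(P₁ : ℝ) ^ (η / 10)⌋₊ : ℕ) : ℝ) ≤ ((P₁ : ℝ) / 2) ^ (η / 4) := by
  have hp : (0 : ℝ) < P₁ := by exact_mod_cast (by omega : 0 < P₁)
  refine (UU_le (η := η) hp).trans ?_
  rw [div_rpow hp.le (by norm_num), le_div_iff₀ (by positivity)]
  have := monomial_le (κ := 2 ^ (η / 4)) (θ := 1) (e := η / 5) (f := η / 4) hp
    (by rw [one_mul]; convert hlarge using 2; ring)
  linarith

end Summit.Parity.BatemanHorn.Cruxes.SplitBlockJacobiCorner.Sketch.MbbOfBoxInputs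

namespace Summit.Parity.BatemanHorn.Cruxes.SplitBlockJacobiCorner.Sketch

/-- **Registered stub form** (`X = P₁P₂ ≤ 8P₁^{2+δ₀}` from the aspect bound): restated in `∀`-form in the crux-line namespace under
the name registered on stmt-Parity-15002. [folklore] -/
theorem mbbParamsA_X_le :
    ∀ p q δ₀ : ℝ, 0 < p → q ≤ 8 * p ^ (1 + δ₀) → p * q ≤ 8 * p ^ (2 + δ₀) :=
  fun _ _ _ hp hasp => MbbOfBoxInputs.X_le hp hasp

end Summit.Parity.BatemanHorn.Cruxes.SplitBlockJacobiCorner.Sketch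

end
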